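import Summits.MatrixMultiplication.MatrixMultiplication.Theorems.GradedDesignFamily.Negative.SubfieldCellFrobenius

/-!
# Subfield cell: (F1) — `|SL₂(k) ∩ g SL₂(k) g⁻¹| ≤ 2q` off the normaliser

Unit `b2b-lgcu-subfield` (gen 20), supporting `stmt-MatrixMultiplication-7610`; second file of the
BGT-free plan (SUBFIELD.md §25, `BGTFreePlan.F1`).  For `ι : k →+* K` with `|K| = |k|²`, `S₀ = SL₂(ι k)`
and `g ∈ SL₂(K)` OUTSIDE the normaliser of `S₀`:

  `#{h ∈ SL₂(k) | g⁻¹ ι(h) g ∈ S₀} ≤ 2·|k|`   (`subfieldCell_twistedCentralizer_card_le`).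

Proof: `g⁻¹ ι(h) g ∈ S₀` iff it is Frobenius-fixed iff `ι(h)` commutes with the twisted element
`z = g (frob g)⁻¹`, which is not `±1` because `g ∉ N(S₀)`; the commutant of a non-scalar `2 × 2` matrix
is `{x·1 + y·z}` and is commutative, so all such `h` commute with one non-scalar `h₀` among them (or all
are `±1`), hence are of the form `x·1 + y·h₀` with `x² + (tr h₀) x y + y² = 1` — at most two `x` per `y`.

HONEST FRAMING: a finite-group lemma toward an unconditional `¬ stub_subfieldCell`; NOT summit progress.
-/

set_option linter.dupNamespace false

namespace Summit.MatrixMultiplication.MatrixMultiplication.Theorems.GradedDesignFamily.Negative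

open scoped MatrixGroups
open Matrix.SpecialLinearGroup

/-! ## The commutant of a non-scalar `2 × 2` matrix -/

/-- Over a field, a matrix commuting with a non-scalar `2 × 2` matrix `z` is of the form
`x•1 + y•z`. -/
theorem exists_eq_smul_one_add_smul_of_commute {F : Type} [Field F] (z m : Matrix (Fin 2) (Fin 2) F)
    (hz : ¬ (z 0 1 = 0 ∧ z 1 0 = 0 ∧ z 0 0 = z 1 1)) (hm : m * z = z * m) :
    ∃ x y : F, m = x • (1 : Matrix (Fin 2) (Fin 2) F) + y • z := by
  have e00 := congrFun (congrFun hm 0) 0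
  have e01 := congrFun (congrFun hm 0) 1
  have e10 := congrFun (congrFun hm 1) 0
  have e11 := congrFun (congrFun hm 1) 1
  simp only [Matrix.mul_apply, Fin.sum_univ_two] at e00 e01 e10 e11
  by_cases hb : z 0 1 = 0
  · by_cases hc : z 1 0 = 0
    · -- diagonal, non-scalar
      have had : z 0 0 - z 1 1 ≠ 0 := by
        intro h; exact hz ⟨hb, hc, by linear_combination h⟩
      refine ⟨m 0 0 - (m 0 0 - m 1 1) / (z 0 0 - z 1 1) * z 0 0,
        (m 0 0 - m 1 1) / (z 0 0 - z 1 1), ?_⟩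
      have hq : m 0 1 = 0 := by
        have h1 : m 0 1 * (z 0 0 - z 1 1) = 0 := by
          rw [hb] at e01; linear_combination -e01
        rcases mul_eq_zero.mp h1 with h | h
        · exact h
        · exact absurd h had
      have hr : m 1 0 = 0 := by
        have h1 : m 1 0 * (z 0 0 - z 1 1) = 0 := by
          rw [hc] at e10; linear_combination e10
        rcases mul_eq_zero.mp h1 with h | h
        · exact h
        · exact absurd h had
      ext i j
      fin_cases i <;> fin_cases j
      · simp
      · simp [hb, hq]
      · simp [hc, hr]
      · simp
        field_simp
        ring
    · -- `z 1 0 ≠ 0`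
      refine ⟨m 0 0 - m 1 0 / z 1 0 * z 0 0, m 1 0 / z 1 0, ?_⟩
      have hq : m 0 1 = 0 := by
        have h1 : m 0 1 * z 1 0 = 0 := by rw [hb] at e00; linear_combination e00
        rcases mul_eq_zero.mp h1 with h | h
        · exact h
        · exact absurd h hc
      ext i j
      fin_cases i <;> fin_cases j
      · simp
      · simp [hb, hq]
      · simp
        field_simp
      · simp
        field_simp
        linear_combination e10
  · -- `z 0 1 ≠ 0`
    refine ⟨m 0 0 - m 0 1 / z 0 1 * z 0 0, m 0 1 / z 0 1, ?_⟩
    ext i j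
    fin_cases i <;> fin_cases j
    · simp
    · simp
      field_simp
    · simp
      field_simp
      linear_combination -e00
    · simp
      field_simp
      linear_combination -e01

/-- Elements of the commutant of a non-scalar `2 × 2` matrix commute with each other. -/
theorem commute_of_commute_nonscalar {F : Type} [Field F] (z m m' : Matrix (Fin 2) (Fin 2) F)
    (hz : ¬ (z 0 1 = 0 ∧ z 1 0 = 0 ∧ z 0 0 = z 1 1)) (hm : m * z = z * m) (hm' : m' * z = z * m') :
    m * m' = m' * m := by
  obtain ⟨x, y, rfl⟩ := exists_eq_smul_one_add_smul_of_commute z m hz hm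
  obtain ⟨x', y', rfl⟩ := exists_eq_smul_one_add_smul_of_commute z m' hz hm'
  have h : Commute (x • (1 : Matrix (Fin 2) (Fin 2) F) + y • z) (x' • 1 + y' • z) :=
    ((Commute.one_left _).smul_left x).add_left ((Commute.add_right
      ((Commute.one_right z).smul_right x') ((Commute.refl z).smul_right y')).smul_left y)
  exact h

/-- A scalar matrix of determinant one over a field is `±1`. -/
theorem eq_one_or_eq_neg_one_of_scalar {F : Type} [Field F] (m : Matrix (Fin 2) (Fin 2) F)
    (hs : m 0 1 = 0 ∧ m 1 0 = 0 ∧ m 0 0 = m 1 1) (hdet : m.det = 1) : m = 1 ∨ m = -1 := by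
  obtain ⟨h01, h10, h00⟩ := hs
  rw [Matrix.det_fin_two, h01, h10, ← h00] at hdet
  have hc : (m 0 0 - 1) * (m 0 0 + 1) = 0 := by linear_combination hdet
  rcases mul_eq_zero.mp hc with h | h
  · left
    ext i j
    fin_cases i <;> fin_cases j
    · simp; linear_combination h
    · simp [h01]
    · simp [h10]
    · simp; linear_combination h - h00
  · right
    ext i j
    fin_cases i <;> fin_cases j
    · simp; linear_combination h
    · simp [h01]
    · simp [h10]
    · simp; linear_combination h - h00

/-! ## Counting solutions of `det (x•1 + y•h₀) = 1` -/

open Polynomial in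
/-- For fixed `y`, at most two `x` satisfy `x² + b x + c = 0`. -/
theorem card_filter_quadratic_le {F : Type} [Field F] [Fintype F] [DecidableEq F] (b c : F) :
    (Finset.univ.filter fun x : F => x ^ 2 + b * x + c = 0).card ≤ 2 := by
  set p : F[X] := C 1 * X ^ 2 + C b * X + C c with hp
  have hp0 : p ≠ 0 := by
    intro h0
    have := congrArg (fun r : F[X] => r.coeff 2) h0
    simp [hp] at this
  have hsub : (Finset.univ.filter fun x : F => x ^ 2 + b * x + c = 0) ⊆ p.roots.toFinset := by
    intro x hx
    simp only [Finset.mem_filter, Finset.mem_univ, true_and] at hx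
    rw [Multiset.mem_toFinset, Polynomial.mem_roots hp0]
    simp [hp, hx]
  calc _ ≤ p.roots.toFinset.card := Finset.card_le_card hsub
    _ ≤ p.roots.card := Multiset.toFinset_card_le _
    _ ≤ p.natDegree := Polynomial.card_roots' _
    _ ≤ 2 := Polynomial.natDegree_quadratic_le

/-- `det (x•1 + y•h₀) = x² + (tr h₀)·x·y + y²` for `det h₀ = 1`. -/
theorem det_smul_one_add_smul {F : Type} [Field F] (h₀ : Matrix (Fin 2) (Fin 2) F)
    (hdet : h₀.det = 1) (x y : F) :
    (x • (1 : Matrix (Fin 2) (Fin 2) F) + y • h₀).det =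
      x ^ 2 + (h₀ 0 0 + h₀ 1 1) * y * x + y ^ 2 := by
  rw [Matrix.det_fin_two] at hdet ⊢
  simp [Matrix.add_apply, Matrix.smul_apply]
  linear_combination (y ^ 2) * hdet

/-- At most `2·|F|` pairs `(x, y)` have `det (x•1 + y•h₀) = 1` (for `det h₀ = 1`). -/
theorem card_filter_det_smul_le {F : Type} [Field F] [Fintype F] [DecidableEq F]
    (h₀ : Matrix (Fin 2) (Fin 2) F) (hdet : h₀.det = 1) :
    (Finset.univ.filter fun xy : F × F =>
        (xy.1 • (1 : Matrix (Fin 2) (Fin 2) F) + xy.2 • h₀).det = 1).card ≤ 2 * Fintype.card F := by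
  rw [← Finset.card_univ (α := F)]
  refine Finset.card_le_mul_card_image_of_maps_to (f := Prod.snd) (t := Finset.univ)
    (fun _ _ => Finset.mem_univ _) 2 ?_
  intro y _
  -- the fibre over `y` injects into the solutions of a monic quadratic in `x`
  have hsub : ((Finset.univ.filter fun xy : F × F =>
        (xy.1 • (1 : Matrix (Fin 2) (Fin 2) F) + xy.2 • h₀).det = 1).filter fun xy => xy.2 = y) ⊆
      (Finset.univ.filter fun x : F =>
        x ^ 2 + ((h₀ 0 0 + h₀ 1 1) * y) * x + (y ^ 2 - 1) = 0).image fun x => (x, y) := by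
    intro xy hxy
    simp only [Finset.mem_filter, Finset.mem_univ, true_and] at hxy
    obtain ⟨hd, rfl⟩ := hxy
    refine Finset.mem_image.mpr ⟨xy.1, ?_, rfl⟩
    simp only [Finset.mem_filter, Finset.mem_univ, true_and]
    rw [det_smul_one_add_smul h₀ hdet] at hd
    linear_combination hd
  calc _ ≤ _ := Finset.card_le_card hsub
    _ ≤ _ := Finset.card_image_le
    _ ≤ 2 := card_filter_quadratic_le _ _

/-! ## (F1) -/

variable {k K : Type} [Field k] [Fintype k] [DecidableEq k] [Field K] [Fintype K] [DecidableEq K]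

omit [DecidableEq k] in
/-- The conjugation condition is a commutation condition with the twisted element
`z = g (frob g)⁻¹`. -/
theorem conj_mem_subfieldSL_iff (ι : k →+* K)
    (σ : K →+* K) (hσ : ∀ x, σ x = x ^ Fintype.card k) (g : SL(2, K))
    (h : SL(2, k)) :
    g⁻¹ * map ι h * g ∈ (map (n := Fin 2) ι).range ↔
      g * (map σ g)⁻¹ * map ι h =
        map ι h * (g * (map σ g)⁻¹) := by
  rw [mem_subfieldSL_iff ι σ hσ, map_mul, map_mul, map_inv, frobSL_map ι σ hσ]
  constructor
  · intro e
    calc g * (map σ g)⁻¹ * map ι h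
        = g * ((map σ g)⁻¹ * map ι h * map σ g) * (map σ g)⁻¹ := by
          group
      _ = g * (g⁻¹ * map ι h * g) * (map σ g)⁻¹ := by rw [e]
      _ = map ι h * (g * (map σ g)⁻¹) := by group
  · intro e
    calc (map σ g)⁻¹ * map ι h * map σ g
        = g⁻¹ * (g * (map σ g)⁻¹ * map ι h) * map σ g := by group
      _ = g⁻¹ * (map ι h * (g * (map σ g)⁻¹)) * map σ g := by rw [e]
      _ = g⁻¹ * map ι h * g := by group

omit [DecidableEq k] in
/-- Off the normaliser, the twisted element `z = g (frob g)⁻¹` is a non-scalar matrix. -/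
theorem twisted_nonscalar (ι : k →+* K)
    (σ : K →+* K) (hσ : ∀ x, σ x = x ^ Fintype.card k) {g : SL(2, K)}
    (hg : g ∉ Subgroup.normalizer (SetLike.coe (map (n := Fin 2) ι).range)) :
    ¬ (((g * (map σ g)⁻¹ : SL(2, K)) : Matrix (Fin 2) (Fin 2) K) 0 1 = 0 ∧
       ((g * (map σ g)⁻¹ : SL(2, K)) : Matrix (Fin 2) (Fin 2) K) 1 0 = 0 ∧
       ((g * (map σ g)⁻¹ : SL(2, K)) : Matrix (Fin 2) (Fin 2) K) 0 0 =
       ((g * (map σ g)⁻¹ : SL(2, K)) : Matrix (Fin 2) (Fin 2) K) 1 1) := by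
  intro hs
  apply hg
  apply mem_normalizer_of_frobSL ι σ hσ
  set z : SL(2, K) := g * (map σ g)⁻¹ with hz
  have hz1 := eq_one_or_eq_neg_one_of_scalar (z : Matrix (Fin 2) (Fin 2) K) hs z.det_coe
  rcases hz1 with e | e
  · left
    have hz' : z = 1 := by ext i j; rw [e]; simp
    have : g = map σ g := by
      calc g = z * map σ g := by rw [hz]; group
        _ = map σ g := by rw [hz', one_mul]
    exact this.symm
  · right
    have hz' : z = -1 := by
      ext i j; rw [e]; simp
    calc map σ g = z⁻¹ * g := by rw [hz]; group
      _ = -g := by rw [hz', subfieldCell_neg_inv, inv_one, neg_mul, one_mul]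

/-- **(F1)** `#{h ∈ SL₂(k) | g⁻¹ ι(h) g ∈ S₀} ≤ 2·|k|` for `g ∉ N(S₀)` — the shape of
`BGTFreePlan.F1`. -/
theorem subfieldCell_twistedCentralizer_card_le (k K : Type) [Field k] [Fintype k] [DecidableEq k]
    [Field K] [Fintype K] [DecidableEq K] (ι : k →+* K)
    (_hK : Fintype.card K = Fintype.card k ^ 2)
    (g : SL(2, K)) (hg : g ∉ Subgroup.normalizer (SetLike.coe (map (n := Fin 2) ι).range)) :
    Nat.card {h : SL(2, k) //
      g⁻¹ * map ι h * g ∈ (map (n := Fin 2) ι).range} ≤ 2 * Fintype.card k := by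
  classical
  obtain ⟨σ, hσ⟩ := exists_frobenius ι
  set z : SL(2, K) := g * (map σ g)⁻¹ with hz
  set zM : Matrix (Fin 2) (Fin 2) K := (z : Matrix (Fin 2) (Fin 2) K) with hzM
  have hzns := twisted_nonscalar ι σ hσ hg
  rw [← hz] at hzns
  -- the commutation set
  set Cz : Finset (SL(2, k)) := Finset.univ.filter fun h =>
      ι.mapMatrix (h : Matrix (Fin 2) (Fin 2) k) * zM =
        zM * ι.mapMatrix (h : Matrix (Fin 2) (Fin 2) k)
    with hCz
  have hmem : ∀ h : SL(2, k),
      g⁻¹ * map ι h * g ∈ (map (n := Fin 2) ι).range → h ∈ Cz := by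
    intro h hh
    rw [conj_mem_subfieldSL_iff ι σ hσ, ← hz] at hh
    have hh' := congrArg (fun x : SL(2, K) => (x : Matrix (Fin 2) (Fin 2) K)) hh
    simp only [Matrix.SpecialLinearGroup.coe_mul] at hh'
    simp only [hCz, Finset.mem_filter, Finset.mem_univ, true_and, hzM]
    have e : (map ι h : Matrix (Fin 2) (Fin 2) K) =
        ι.mapMatrix (h : Matrix (Fin 2) (Fin 2) k) := by
      simp [Matrix.SpecialLinearGroup.map]
    rw [← e]
    exact hh'.symm
  -- reduce to bounding `Cz`
  have hle : Nat.card {h : SL(2, k) //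
      g⁻¹ * map ι h * g ∈ (map (n := Fin 2) ι).range} ≤ Cz.card := by
    rw [Nat.card_eq_fintype_card, Fintype.card_subtype]
    exact Finset.card_le_card fun h hh => hmem h (by simpa using hh)
  refine hle.trans ?_
  have hq2 : 2 ≤ Fintype.card k := Fintype.one_lt_card
  -- case split: is there a non-scalar element in `Cz`?
  by_cases hex : ∃ h₀ ∈ Cz, ¬ (((h₀ : SL(2, k)) : Matrix (Fin 2) (Fin 2) k) 0 1 = 0 ∧
      ((h₀ : SL(2, k)) : Matrix (Fin 2) (Fin 2) k) 1 0 = 0 ∧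
      ((h₀ : SL(2, k)) : Matrix (Fin 2) (Fin 2) k) 0 0 =
      ((h₀ : SL(2, k)) : Matrix (Fin 2) (Fin 2) k) 1 1)
  · obtain ⟨h₀, hh₀, hns⟩ := hex
    set H₀ : Matrix (Fin 2) (Fin 2) k := (h₀ : Matrix (Fin 2) (Fin 2) k) with hH₀
    have hh₀' : ι.mapMatrix H₀ * zM = zM * ι.mapMatrix H₀ := by
      simp only [hCz, Finset.mem_filter, Finset.mem_univ, true_and] at hh₀; exact hh₀
    have hinjM : Function.Injective
        (ι.mapMatrix : Matrix (Fin 2) (Fin 2) k → Matrix (Fin 2) (Fin 2) K) := by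
      intro a b hab
      ext i j
      have := congrFun (congrFun hab i) j
      exact ι.injective (by simpa using this)
    -- every element of `Cz` commutes with `h₀`
    have hcomm : ∀ h ∈ Cz,
        (h : Matrix (Fin 2) (Fin 2) k) * H₀ = H₀ * (h : Matrix (Fin 2) (Fin 2) k) := by
      intro h hh
      simp only [hCz, Finset.mem_filter, Finset.mem_univ, true_and] at hh
      have hc := commute_of_commute_nonscalar zM _ _ hzns hh hh₀'
      rw [← map_mul, ← map_mul] at hc
      exact hinjM hc
    have hdet0 : H₀.det = 1 := h₀.det_coe
    set T : Finset (k × k) := Finset.univ.filter fun xy : k × k =>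
        (xy.1 • (1 : Matrix (Fin 2) (Fin 2) k) + xy.2 • H₀).det = 1 with hT
    have hsub : Cz.image (fun h : SL(2, k) => (h : Matrix (Fin 2) (Fin 2) k)) ⊆
        T.image fun xy : k × k => xy.1 • (1 : Matrix (Fin 2) (Fin 2) k) + xy.2 • H₀ := by
      intro M hM
      obtain ⟨h, hh, rfl⟩ := Finset.mem_image.mp hM
      obtain ⟨x, y, hxy⟩ := exists_eq_smul_one_add_smul_of_commute H₀ _ hns (hcomm h hh)
      refine Finset.mem_image.mpr ⟨(x, y), ?_, hxy.symm⟩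
      simp only [hT, Finset.mem_filter, Finset.mem_univ, true_and]
      rw [← hxy]
      exact h.det_coe
    calc Cz.card = (Cz.image fun h : SL(2, k) =>
          (h : Matrix (Fin 2) (Fin 2) k)).card :=
          (Finset.card_image_of_injective _ (fun a b hab => Subtype.ext hab)).symm
      _ ≤ (T.image fun xy : k × k => xy.1 • (1 : Matrix (Fin 2) (Fin 2) k) + xy.2 • H₀).card :=
          Finset.card_le_card hsub
      _ ≤ T.card := Finset.card_image_le
      _ ≤ 2 * Fintype.card k := card_filter_det_smul_le H₀ hdet0
  · -- all elements of `Cz` are scalar, hence `±1`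
    push Not at hex
    have hsub : Cz ⊆ {1, -1} := by
      intro h hh
      have hs := hex h hh
      rcases eq_one_or_eq_neg_one_of_scalar (h : Matrix (Fin 2) (Fin 2) k) hs h.det_coe with e | e
      · have : h = 1 := by ext i j; rw [e]; simp
        simp [this]
      · have : h = -1 := by ext i j; rw [e]; simp
        simp [this]
    calc Cz.card ≤ ({1, -1} : Finset (SL(2, k))).card := Finset.card_le_card hsub
      _ ≤ 2 := Finset.card_le_two
      _ ≤ 2 * Fintype.card k := by omega

end Summit.MatrixMultiplication.MatrixMultiplication.Theorems.GradedDesignFamily.Negative
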